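import Literature.Algebra.Homology.DiscreteRepLayerColimitBoundedCofinal
import HarnessLib

/-!
# The `p`-torsion of `Hⁿ_cont(Γ, M)` is finite, of order `≤ #T`, when on a COFINAL family of layers the `p`-torsion
# classes of `Hⁿ(Γ⧸W, M^W)` carry a `T`-valued invariant that determines their image in the limit
# (Serre I §2.2 Prop. 8; the counting behind NSW (8.3.11) (ii)/(iii) `H²(G_S, 𝒪_S^×)[p] ↪ ⊕_{v ∈ S} (ℚ/ℤ)[p]`)

Topic `Algebra/Homology`; namespace `Literature.Algebra.Homology.DiscreteRep.LayerColimit`.  THEOREMS ONLY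
(no definition, no named fact, no `sorry`, no instance; D-0026).  Sequel of `DiscreteRepLayerColimitBounded{,Cofinal}`
and `DiscreteRepLayerColimitGroupCohomology` (`stepG`, `inflG`, `inflG_stepG`, `stepG_stepG`, `exists_inflG_eq`,
`exists_stepG_eq_zero`).

THE COUNTING.  Let `T` be a finite type and suppose that every open normal `U ≤ Γ` contains an open normal `W` together
with a function `θ` from the `p`-torsion classes of `Hⁿ(Γ⧸W, M^W)` to `T` such that two `p`-torsion classes with the
same `θ`-value have the same image in `Extⁿ_{C_Γ}(k, M)` (`inflG`).  Then every finite set `s` of `p`-torsion classes of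
`Extⁿ_{C_Γ}(k, M)` has `s.card ≤ #T` (`finsetCard_le_of_cofinal_torsion_invariant`): the classes of `s` are inflated from
layers `U_x`; `p • x = 0` in the limit means `p • c_x` dies in a deeper layer `V_x ≤ U_x`; a common refinement `U₀` of the
`V_x` contains a `W` as in the hypothesis; pushed to `W` the classes are `p`-torsion, recover `x` under `inflG W`, so
`θ ∘ (push)` is injective on `s`.  Hence `{x | p • x = 0}` is finite with `Nat.card ≤ #T`
(`finite_torsion_ext_of_cofinal_invariant`, `natCard_torsion_ext_le_of_cofinal_invariant`), and the same for Mathlib's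
`Hⁿ_cont(Γ, X)` through `Φ : Extⁿ_{C_Γ}(k, X) ≃+ Hⁿ_cont(Γ, X)` (`finsetCard_continuousCohomology_le_of_cofinal_torsion_invariant`,
`finite_torsion_continuousCohomology_of_cofinal_invariant`, `natCard_torsion_continuousCohomology_le_of_cofinal_invariant`).

Written for lane «TATE-EPC-TC» of cell `bsd-eis` (crux `GoodLatticeBDPValue`, stmt-BirchSwinnertonDyer-19032; brick (F2b):
`Γ = U ≤ G_{K,S}` open, `M = E_S`, `n = 2`, `θ` = the local invariants at the places of `F₀ = K̄^H` above `S` of the image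
in `H²(Gal(E/F₀), J_{E,S})`, `T = (S₀ → (ℚ/ℤ)[p])`; the layers `Gal(K_S/E)` with `E/K` Galois are only cofinal).

## References
* J.-P. Serre, *Cohomologie galoisienne* (1994), I §2.2 Prop. 8. [SerreGaloisCohomology1997]
* J. Neukirch, A. Schmidt, K. Wingberg, *Cohomology of Number Fields*, 2nd ed. (2008), (1.5.1), (8.3.11) (ii)/(iii) (proof).
  [NeukirchSchmidtWingberg2008]
* D. Harari, *Galois Cohomology and Class Field Theory* (2020), Prop. 4.18, Remark 4.24. [Harari2020]
-/

noncomputable section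

namespace Literature.Algebra.Homology

namespace DiscreteRep

namespace LayerColimit

open CategoryTheory CategoryTheory.Limits CategoryTheory.Abelian

universe u v

variable {k Γ : Type u} [CommRing k] [Group Γ] [TopologicalSpace Γ] [IsTopologicalGroup Γ]
  [CompactSpace Γ] [TotallyDisconnectedSpace Γ]

/-! ### §1 On `Extⁿ_{C_Γ}(k, M)` -/

/-- **COUNTING `p`-TORSION CLASSES THROUGH A LAYER INVARIANT.**  If every open normal `U ≤ Γ` contains an open normal
`W` with a `T`-valued function `θ` on the `p`-torsion classes of `Hⁿ(Γ⧸W, M^W)` such that `θ c = θ c'` forces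
`inflG W c = inflG W c'`, then every finite set of `p`-torsion classes of `Extⁿ_{C_Γ}(k, M)` has at most `#T` elements.
[cite: SerreGaloisCohomology1997, I §2.2 Prop. 8] [cite: NeukirchSchmidtWingberg2008, (1.5.1)] -/
theorem finsetCard_le_of_cofinal_torsion_invariant (n p : ℕ) (M : DiscreteRepCat k Γ) {T : Type v} [Finite T]
    (h : ∀ U : OpenNormalSubgroup Γ, ∃ (W : OpenNormalSubgroup Γ) (_ : (W : Subgroup Γ) ≤ U)
      (θ : {c : groupCohomology ((invariantsQuotFunctor k (W : Subgroup Γ)).obj M) n // p • c = 0} → T),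
      ∀ c c', θ c = θ c' → inflG W M n c.1 = inflG W M n c'.1)
    (s : Finset (Ext (triv (Γ := Γ) k) M n)) (hs : ∀ x ∈ s, p • x = 0) : s.card ≤ Nat.card T := by
  classical
  -- each class is inflated from some layer
  choose U c hc using fun x : Ext (triv (Γ := Γ) k) M n => exists_inflG_eq n M x
  -- for `x ∈ s`, `p • c_x` dies in a deeper layer `V_x ≤ U_x`
  have hdies : ∀ x : {x // x ∈ s}, ∃ (V : OpenNormalSubgroup Γ) (hV : (V : Subgroup Γ) ≤ U x.1),
      stepG (U x.1) V hV M n (p • c x.1) = 0 := fun x =>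
    exists_stepG_eq_zero n M (U x.1) (p • c x.1) (by rw [map_nsmul, hc, hs x.1 x.2])
  choose V hVU hV using hdies
  -- a common refinement `U₀` of the `V_x`, and the layer `W ≤ U₀` carrying the invariant `θ`
  obtain ⟨U₀, hU₀⟩ := exists_openNormalSubgroup_le_of_finset (Finset.univ : Finset {x // x ∈ s}) V ⟨⊤, by simp⟩
  obtain ⟨W, hWU₀, θ, hθ⟩ := h U₀
  have hWV : ∀ x : {x // x ∈ s}, (W : Subgroup Γ) ≤ V x := fun x => hWU₀.trans (hU₀ x (Finset.mem_univ x))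
  -- push the classes to `W`: they are `p`-torsion there
  let f : {x // x ∈ s} →
      {c : groupCohomology ((invariantsQuotFunctor k (W : Subgroup Γ)).obj M) n // p • c = 0} :=
    fun x => ⟨stepG (U x.1) W ((hWV x).trans (hVU x)) M n (c x.1), by
      rw [← map_nsmul, ← stepG_stepG (U x.1) (V x) (hVU x) M n W (hWV x) (p • c x.1), hV x, map_zero]⟩
  have hf : ∀ x : {x // x ∈ s}, inflG W M n (f x).1 = x.1 := fun x => by
    simp only [f, inflG_stepG, hc]
  -- `θ ∘ f` is injective
  have hinj : Function.Injective (θ ∘ f) := fun x y hxy => by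
    have h1 := hθ _ _ hxy
    rw [hf x, hf y] at h1
    exact Subtype.ext h1
  calc s.card = Nat.card {x // x ∈ s} := by rw [Nat.card_eq_fintype_card, Fintype.card_coe]
    _ ≤ Nat.card T := Nat.card_le_card_of_injective _ hinj

/-- **The `p`-torsion of `Extⁿ_{C_Γ}(k, M)` is finite** under the hypothesis of
`finsetCard_le_of_cofinal_torsion_invariant`. [cite: SerreGaloisCohomology1997, I §2.2 Prop. 8] -/
theorem finite_torsion_ext_of_cofinal_invariant (n p : ℕ) (M : DiscreteRepCat k Γ) {T : Type v} [Finite T]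
    (h : ∀ U : OpenNormalSubgroup Γ, ∃ (W : OpenNormalSubgroup Γ) (_ : (W : Subgroup Γ) ≤ U)
      (θ : {c : groupCohomology ((invariantsQuotFunctor k (W : Subgroup Γ)).obj M) n // p • c = 0} → T),
      ∀ c c', θ c = θ c' → inflG W M n c.1 = inflG W M n c'.1) :
    {x : Ext (triv (Γ := Γ) k) M n | p • x = 0}.Finite := by
  classical
  by_contra hinf
  have hinf' : {x : Ext (triv (Γ := Γ) k) M n | p • x = 0}.Infinite := hinf
  obtain ⟨s, hs, hcard⟩ := hinf'.exists_subset_card_eq (Nat.card T + 1)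
  have := finsetCard_le_of_cofinal_torsion_invariant n p M h s fun x hx => hs hx
  omega

/-- **`#{x ∈ Extⁿ_{C_Γ}(k, M) | p • x = 0} ≤ #T`** under the hypothesis of `finsetCard_le_of_cofinal_torsion_invariant`.
[cite: SerreGaloisCohomology1997, I §2.2 Prop. 8] -/
theorem natCard_torsion_ext_le_of_cofinal_invariant (n p : ℕ) (M : DiscreteRepCat k Γ) {T : Type v} [Finite T]
    (h : ∀ U : OpenNormalSubgroup Γ, ∃ (W : OpenNormalSubgroup Γ) (_ : (W : Subgroup Γ) ≤ U)
      (θ : {c : groupCohomology ((invariantsQuotFunctor k (W : Subgroup Γ)).obj M) n // p • c = 0} → T),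
      ∀ c c', θ c = θ c' → inflG W M n c.1 = inflG W M n c'.1) :
    Nat.card {x : Ext (triv (Γ := Γ) k) M n // p • x = 0} ≤ Nat.card T := by
  classical
  have hfin := finite_torsion_ext_of_cofinal_invariant n p M h
  haveI : Fintype {x : Ext (triv (Γ := Γ) k) M n // p • x = 0} := hfin.fintype
  rw [Nat.card_eq_fintype_card, ← Finset.card_univ,
    ← Finset.card_map (Function.Embedding.subtype fun x : Ext (triv (Γ := Γ) k) M n => p • x = 0)]
  refine finsetCard_le_of_cofinal_torsion_invariant n p M h _ fun x hx => ?_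
  obtain ⟨y, -, rfl⟩ := Finset.mem_map.1 hx
  exact y.2

/-! ### §2 On `Hⁿ_cont(Γ, X)` (Mathlib's continuous cohomology), through `Φ` -/

variable [TopologicalSpace k]

open TopRep in
/-- **Counting `p`-torsion classes of `Hⁿ_cont(Γ, X)` through a layer invariant** (transport of
`finsetCard_le_of_cofinal_torsion_invariant` along `Φ : Extⁿ_{C_Γ}(k, X) ≃+ Hⁿ_cont(Γ, X)`).
[cite: SerreGaloisCohomology1997, I §2.2 Prop. 8] [cite: Harari2020, Prop. 4.18, Remark 4.24] -/
theorem finsetCard_continuousCohomology_le_of_cofinal_torsion_invariant (X : TopRep.{u} k Γ) [DiscreteTopology X.V]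
    (hX : IsDiscrete ((forgetTop k Γ).obj X)) (n p : ℕ) {T : Type v} [Finite T]
    (h : ∀ U : OpenNormalSubgroup Γ, ∃ (W : OpenNormalSubgroup Γ) (_ : (W : Subgroup Γ) ≤ U)
      (θ : {c : groupCohomology ((invariantsQuotFunctor k (W : Subgroup Γ)).obj (stdBase X hX)) n // p • c = 0} → T),
      ∀ c c', θ c = θ c' → inflG W (stdBase X hX) n c.1 = inflG W (stdBase X hX) n c'.1)
    (s : Finset (continuousCohomology n X : TopModuleCat.{u} k)) (hs : ∀ y ∈ s, p • y = 0) :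
    s.card ≤ Nat.card T := by
  classical
  let Φ := extTrivAddEquivContinuousCohomology X hX n
  calc s.card = (s.image Φ.symm).card := (Finset.card_image_of_injective _ Φ.symm.injective).symm
    _ ≤ Nat.card T := finsetCard_le_of_cofinal_torsion_invariant n p (stdBase X hX) h _ fun x hx => by
        obtain ⟨y, hy, rfl⟩ := Finset.mem_image.1 hx
        rw [← map_nsmul, hs y hy, map_zero]

open TopRep in
/-- **The `p`-torsion of `Hⁿ_cont(Γ, X)` is finite** under the hypothesis of
`finsetCard_continuousCohomology_le_of_cofinal_torsion_invariant`.
[cite: SerreGaloisCohomology1997, I §2.2 Prop. 8] [cite: Harari2020, Prop. 4.18, Remark 4.24] -/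
theorem finite_torsion_continuousCohomology_of_cofinal_invariant (X : TopRep.{u} k Γ) [DiscreteTopology X.V]
    (hX : IsDiscrete ((forgetTop k Γ).obj X)) (n p : ℕ) {T : Type v} [Finite T]
    (h : ∀ U : OpenNormalSubgroup Γ, ∃ (W : OpenNormalSubgroup Γ) (_ : (W : Subgroup Γ) ≤ U)
      (θ : {c : groupCohomology ((invariantsQuotFunctor k (W : Subgroup Γ)).obj (stdBase X hX)) n // p • c = 0} → T),
      ∀ c c', θ c = θ c' → inflG W (stdBase X hX) n c.1 = inflG W (stdBase X hX) n c'.1) :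
    {y : (continuousCohomology n X : TopModuleCat.{u} k) | p • y = 0}.Finite := by
  classical
  by_contra hinf
  have hinf' : {y : (continuousCohomology n X : TopModuleCat.{u} k) | p • y = 0}.Infinite := hinf
  obtain ⟨s, hs, hcard⟩ := hinf'.exists_subset_card_eq (Nat.card T + 1)
  have := finsetCard_continuousCohomology_le_of_cofinal_torsion_invariant X hX n p h s fun x hx => hs hx
  omega

open TopRep in
/-- **`#{y ∈ Hⁿ_cont(Γ, X) | p • y = 0} ≤ #T`** under the hypothesis of
`finsetCard_continuousCohomology_le_of_cofinal_torsion_invariant`.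
[cite: SerreGaloisCohomology1997, I §2.2 Prop. 8] [cite: Harari2020, Prop. 4.18, Remark 4.24] -/
theorem natCard_torsion_continuousCohomology_le_of_cofinal_invariant (X : TopRep.{u} k Γ) [DiscreteTopology X.V]
    (hX : IsDiscrete ((forgetTop k Γ).obj X)) (n p : ℕ) {T : Type v} [Finite T]
    (h : ∀ U : OpenNormalSubgroup Γ, ∃ (W : OpenNormalSubgroup Γ) (_ : (W : Subgroup Γ) ≤ U)
      (θ : {c : groupCohomology ((invariantsQuotFunctor k (W : Subgroup Γ)).obj (stdBase X hX)) n // p • c = 0} → T),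
      ∀ c c', θ c = θ c' → inflG W (stdBase X hX) n c.1 = inflG W (stdBase X hX) n c'.1) :
    Nat.card {y : (continuousCohomology n X : TopModuleCat.{u} k) // p • y = 0} ≤ Nat.card T := by
  classical
  have hfin := finite_torsion_continuousCohomology_of_cofinal_invariant X hX n p h
  haveI : Fintype {y : (continuousCohomology n X : TopModuleCat.{u} k) // p • y = 0} := hfin.fintype
  rw [Nat.card_eq_fintype_card, ← Finset.card_univ,
    ← Finset.card_map (Function.Embedding.subtype
      fun y : (continuousCohomology n X : TopModuleCat.{u} k) => p • y = 0)]
  refine finsetCard_continuousCohomology_le_of_cofinal_torsion_invariant X hX n p h _ fun x hx => ?_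
  obtain ⟨y, -, rfl⟩ := Finset.mem_map.1 hx
  exact y.2

end LayerColimit

end DiscreteRep

end Literature.Algebra.Homology

end
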